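import Summits.PneNP.PneNP.Theorems.CliqueExtLowerBound.Negative.LoadBearing
import Literature.Combinatorics.SimpleGraph.LovaszTheta

/-!
# Sketch (crux-ideate, ideator 3, gen 2): first lemmas of three crux ideas for `CliqueExtLowerBound`

Crux `stmt-PneNP-10682` = `Summit.PneNP.PneNP.Theses.ConvexRankGates.CliqueExtLowerBound`.
Defs / Props only (plus two elementary proofs); `lean check` rc 0 is the requirement, not proofs.

* §A card `oddtown-negatives`: `oddtownVec`, `IsOddLabelling`, `OddtownCliqueFree` (Berlekamp's Oddtown
  theorem in clique form — support, provable now), `ExtBlindOnOddtown δ` (the card's C⁺: no small B-circuit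
  SEPARATES bare ⌈m^δ⌉-cliques from Oddtown graphs), `AndOrBlindOnOddtown δ` (the ∧/∨ step, Razborov's
  one-sided method at density 1/2), the PROVED transfer
  `cliqueExtLowerBound_of_extBlindOnOddtown : OddtownCliqueFree → ExtBlindOnOddtown δ → crux`,
  and `HoffmanThetaWitness` (the explicit feasible point `(I + A/λ)/m` of the theta SDP — why the theta
  CONV gate is blind on pseudo-random negatives when δ < 1/2).
* §B card `inline-local-oracles-ledger` (re-created, light form): `IsApproximator`, `OneDirApprox`,
  `SingleGateApproximable` (C⁺⁺), `InlineOracleReduction`.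
* §C card `constant-clique-transfer` (re-created): `CPlus`, `CliqueRestriction`, `ConstantCliqueTransfer`.
-/

set_option linter.dupNamespace false

namespace Summit.PneNP.PneNP.Cruxes.CliqueExtLowerBound.SketchIdeator3

open Literature.Computability.Complexity Filter Finset
open Summit.PneNP.PneNP.Theses.ConvexRankGates (CliqueExtLowerBound)
open Summit.PneNP.PneNP.Theorems.CliqueExtLowerBound.Negative (LowerBoundAt cliqueExtLowerBound_iff
  two_le_ceil_rpow)

/-! ## §A  Card `oddtown-negatives` -/

section Oddtown

variable {m r : ℕ}

/-- Dot product over `𝔽₂` (`Matrix.dotProduct`). [folklore] -/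
def dotZ2 (a b : Fin r → ZMod 2) : ZMod 2 := a ⬝ᵥ b

theorem dotZ2_comm (a b : Fin r → ZMod 2) : dotZ2 a b = dotZ2 b a := dotProduct_comm a b

/-- The ODDTOWN GRAPH of a labelling `A : Fin m → 𝔽₂^r`, as an edge-indicator vector of `K_m`: the edge
`uv` is ON iff `⟨A u, A v⟩ = 0` (even intersection). [folklore] -/
noncomputable def oddtownVec (A : Fin m → Fin r → ZMod 2) : (⊤ : SimpleGraph (Fin m)).edgeSet → Bool :=
  fun e => Sym2.lift ⟨fun u v => decide (dotZ2 (A u) (A v) = 0),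
    fun u v => by dsimp only; rw [dotZ2_comm]⟩ (e : Sym2 (Fin m))

/-- ODD labelling: every label has odd weight, `⟨A v, A v⟩ = 1` over `𝔽₂`. [folklore] -/
def IsOddLabelling (A : Fin m → Fin r → ZMod 2) : Prop := ∀ v, dotZ2 (A v) (A v) = 1

/-- **Oddtown in clique form** (Berlekamp 1969): the Oddtown graph of an odd labelling into `𝔽₂^r` has NO
`(r+1)`-clique — pairwise-orthogonal non-isotropic vectors are linearly independent, and `dim 𝔽₂^r = r`.
SUPPORT item of the card (provable now from Mathlib's `LinearIndependent` / `finrank`). [cite: Berlekamp1969] -/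
def OddtownCliqueFree : Prop :=
  ∀ (m r : ℕ) (A : Fin m → Fin r → ZMod 2), IsOddLabelling A → cliqueFn m (r + 1) (oddtownVec A) = false

/-- Adjacency in the Oddtown graph = orthogonality of the labels. [folklore] -/
theorem oddtownVec_mk (A : Fin m → Fin r → ZMod 2) {u v : Fin m} (h : s(u, v) ∈ (⊤ : SimpleGraph (Fin m)).edgeSet) :
    oddtownVec A ⟨s(u, v), h⟩ = decide (dotZ2 (A u) (A v) = 0) := rfl

/-- **Proof of the Oddtown support item** (Berlekamp): a clique is a pairwise-orthogonal family of
non-isotropic vectors, hence linearly independent over `𝔽₂`, hence of size `≤ dim = r`. [cite: Berlekamp1969] -/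
theorem oddtownCliqueFree_holds : OddtownCliqueFree := by
  intro m r A hA
  rw [cliqueFn_eq_false_iff]
  intro S hS
  -- pairwise orthogonality inside the clique
  have horth : ∀ u ∈ S, ∀ w ∈ S, u ≠ w → A u ⬝ᵥ A w = 0 := by
    intro u hu w hw huw
    have hadj := hS.isClique hu hw huw
    rw [cliqueGraph_adj] at hadj
    obtain ⟨hne, hx⟩ := hadj
    rw [oddtownVec_mk] at hx
    simpa [dotZ2] using hx
  -- linear independence of the clique's labels
  have hli : LinearIndependent (ZMod 2) (fun v : S => A v) := by
    rw [Fintype.linearIndependent_iff]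
    intro g hg i
    have h := congrArg (fun w => w ⬝ᵥ A i) hg
    simp only [sum_dotProduct, smul_dotProduct, zero_dotProduct, smul_eq_mul] at h
    rw [Finset.sum_eq_single i] at h
    · have hii : A i ⬝ᵥ A i = 1 := hA i
      rw [hii, mul_one] at h
      exact h
    · intro j _ hji
      have hne : (j : Fin m) ≠ i := fun e => hji (Subtype.ext e)
      rw [horth j j.2 i i.2 hne, mul_zero]
    · intro hi; exact absurd (Finset.mem_univ i) hi
  have hcard := hli.fintype_card_le_finrank
  rw [Module.finrank_fintype_fun_eq_card, Fintype.card_fin, Fintype.card_coe, hS.card_eq] at hcard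
  omega

/-- **C⁺ of the card (separation form of the crux on the Oddtown pair).** For the exponent `δ`: for every
`c`, eventually in `m`, no circuit with `≤ m^c` gates over the FULL basis `B_{m^c} = extGate (m^c)` accepts
every bare `⌈m^δ⌉`-clique AND rejects every Oddtown graph of dimension `⌈m^δ⌉ - 1`. -/
def ExtBlindOnOddtown (δ : ℝ) : Prop :=
  ∀ c : ℕ, ∀ᶠ m : ℕ in atTop, ∀ C : Circuit ((⊤ : SimpleGraph (Fin m)).edgeSet),
    C.IsOver (extGate (m ^ c)) → C.size ≤ m ^ c →
      ¬ ((∀ S : Finset (Fin m), S.card = ⌈(m : ℝ) ^ δ⌉₊ → C.eval (cliqueVec S) = true) ∧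
         (∀ A : Fin m → Fin (⌈(m : ℝ) ^ δ⌉₊ - 1) → ZMod 2, IsOddLabelling A →
            C.eval (oddtownVec A) = false))

/-- **The ∧/∨ step** (K-support of the card; claimed provable NOW by Razborov's one-sided approximation
method with `(l,M)`-DNF approximators, `l ≈ √((1-δ)/2 · log₂ m)`, plucking `p = 2^{C(l,2)}·L` petals; the
`≤ m^δ/2`-local statistics of Oddtown graphs equal those of `G(m,1/2)` and petal events are conditionally
independent EXACTLY): the same separation statement for `{∧₂, ∨₂}`-circuits. [cite: Razborov1985] -/
def AndOrBlindOnOddtown (δ : ℝ) : Prop :=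
  ∀ c : ℕ, ∀ᶠ m : ℕ in atTop, ∀ C : Circuit ((⊤ : SimpleGraph (Fin m)).edgeSet),
    C.IsOver monotoneBasis → C.size ≤ m ^ c →
      ¬ ((∀ S : Finset (Fin m), S.card = ⌈(m : ℝ) ^ δ⌉₊ → C.eval (cliqueVec S) = true) ∧
         (∀ A : Fin m → Fin (⌈(m : ℝ) ^ δ⌉₊ - 1) → ZMod 2, IsOddLabelling A →
            C.eval (oddtownVec A) = false))

/-- The full-basis statement implies the ∧/∨ one (sanity: `monotoneBasis ⊆ extGate s`). [folklore] -/
theorem andOrBlindOnOddtown_of_ext {δ : ℝ} (h : ExtBlindOnOddtown δ) : AndOrBlindOnOddtown δ := by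
  intro c
  filter_upwards [h c] with m hm C hC hs
  exact hm C (hC.mono (monotoneBasis_subset_extGate _)) hs

/-- **TRANSFER (proved): separation hardness on the Oddtown pair for some `δ ∈ (0,1/2)` implies the crux.**
A circuit computing `CLIQUE(m, ⌈m^δ⌉)` accepts every bare clique (`cliqueFn_cliqueVec`) and rejects every
Oddtown graph (Oddtown theorem), i.e. separates the pair. [folklore] -/
theorem cliqueExtLowerBound_of_extBlindOnOddtown (hO : OddtownCliqueFree) {δ : ℝ} (h0 : 0 < δ)
    (h1 : δ < 1 / 2) (h : ExtBlindOnOddtown δ) : CliqueExtLowerBound := by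
  rw [cliqueExtLowerBound_iff]
  refine ⟨δ, h0, h1, fun c => ?_⟩
  filter_upwards [h c, eventually_ge_atTop 2] with m hm h2 C hC hs hcomp
  refine hm C hC hs ⟨fun S hS => ?_, fun A hA => ?_⟩
  · rw [hcomp]
    exact cliqueFn_cliqueVec hS.ge
  · rw [hcomp]
    have hk : ⌈(m : ℝ) ^ δ⌉₊ - 1 + 1 = ⌈(m : ℝ) ^ δ⌉₊ :=
      Nat.sub_add_cancel (le_trans (by norm_num) (two_le_ceil_rpow h0 h2))
    have := hO m (⌈(m : ℝ) ^ δ⌉₊ - 1) A hA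
    rwa [hk] at this

/-- Unconditional form of the transfer: `ExtBlindOnOddtown δ` for some `δ ∈ (0,1/2)` ⇒ the crux. [folklore] -/
theorem cliqueExtLowerBound_of_extBlindOnOddtown' {δ : ℝ} (h0 : 0 < δ) (h1 : δ < 1 / 2)
    (h : ExtBlindOnOddtown δ) : CliqueExtLowerBound :=
  cliqueExtLowerBound_of_extBlindOnOddtown oddtownCliqueFree_holds h0 h1 h

end Oddtown

section Theta

open Literature.Combinatorics.SimpleGraph Matrix

/-- **Hoffman-type theta witness** (why the theta CONV gate is blind on pseudo-random negatives): for a graph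
`G` on `Fin m` and `λ > 0` with `I + λ⁻¹ A_G ⪰ 0` (e.g. `λ ≥ |λ_min(A_G)|`), the matrix `(I + λ⁻¹A_G)/m` is
feasible for Lovász's programme of `Gᶜ` (psd, trace 1, zero on non-edges of `G`), so
`ϑ(Gᶜ) ≥ 1 + 2|E(G)|/(mλ)`; hence the gate `[ϑ(Ḡ) ≥ k]` ACCEPTS `G` as soon as `1 + d̄/λ ≥ k` — for
`d̄ ≈ m/2`, `λ ≈ √m` this is `k ≲ √m/2`, i.e. exactly `δ < 1/2`. SUPPORT item, provable now. [folklore] -/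
def HoffmanThetaWitness : Prop :=
  ∀ (m : ℕ) (G : SimpleGraph (Fin m)) [DecidableRel G.Adj] (lam : ℝ), 0 < lam → 0 < m →
    ((1 : Matrix (Fin m) (Fin m) ℝ) + lam⁻¹ • G.adjMatrix ℝ).PosSemidef →
      1 + 2 * (G.edgeFinset.card : ℝ) / (m * lam) ≤ lovaszTheta Gᶜ

end Theta

/-! ## §B  Card `inline-local-oracles-ledger` (light re-creation of the gen-0 sketch) -/

section Ledger

variable {m : ℕ}

/-- `(l,M)`-approximators (Razborov / Alon–Boppana): ORs of at most `M` clique indicators `⌈X⌉`, `#X ≤ l`.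
[cite: AlonBoppana1987] -/
def IsApproximator (m l M : ℕ) (f : ((⊤ : SimpleGraph (Fin m)).edgeSet → Bool) → Bool) : Prop :=
  ∃ 𝓧 : Finset (Finset (Fin m)), 𝓧.card ≤ M ∧ (∀ X ∈ 𝓧, X.card ≤ l) ∧
    ∀ x, f x = decide (∃ X ∈ 𝓧, ∀ e : (⊤ : SimpleGraph (Fin m)).edgeSet,
      (∀ v ∈ (e : Sym2 (Fin m)), v ∈ X) → x e = true)

/-- ONE-DIRECTIONAL `(η⁺, η⁻)`-approximation of `g` by `f` on the referee pair (positives = bare `k`-cliques,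
negatives = a finite test multiset `neg`, standing in for the negative distribution): only "loses a 1 on a
clique" and "gains a 1 on a negative" are charged. -/
def OneDirApprox (m k : ℕ) (neg : Finset ((⊤ : SimpleGraph (Fin m)).edgeSet → Bool))
    (g f : ((⊤ : SimpleGraph (Fin m)).edgeSet → Bool) → Bool) (ηp ηn : ℝ) : Prop :=
  (((powersetCard k (univ : Finset (Fin m))).filter fun S =>
      g (cliqueVec S) = true ∧ f (cliqueVec S) = false).card : ℝ) ≤ ηp * (m.choose k : ℝ) ∧
  ((neg.filter fun y => g y = false ∧ f y = true).card : ℝ) ≤ ηn * (neg.card : ℝ)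

/-- **C⁺⁺ = SingleGateApproximable** (crux K1 of the card, schematic): every gate of `Ext(m^c)` applied to
`(l,M)`-approximators is one-directionally `(m^{-(c+1)}, m^{-(c+1)})`-approximable by an `(l,M)`-approximator
w.r.t. (bare `⌈m^δ⌉`-cliques, the negative test multiset `neg m`). -/
def SingleGateApproximable (neg : ∀ m : ℕ, Finset ((⊤ : SimpleGraph (Fin m)).edgeSet → Bool))
    (δ : ℝ) (l M : ℕ → ℕ) : Prop :=
  ∀ c : ℕ, ∀ᶠ m : ℕ in atTop, ∀ g ∈ extGate (m ^ c),
    ∀ h : Fin g.1 → (((⊤ : SimpleGraph (Fin m)).edgeSet → Bool) → Bool),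
      (∀ i, IsApproximator m (l m) (M m) (h i)) →
        ∃ f, IsApproximator m (l m) (M m) f ∧
          OneDirApprox m ⌈(m : ℝ) ^ δ⌉₊ (neg m) (fun x => g.2 fun i => h i x) f
            ((m : ℝ) ^ (-((c : ℝ) + 1))) ((m : ℝ) ^ (-((c : ℝ) + 1)))

/-- **InlineOracleReduction** (crux K2 of the card): admissible parameters with C⁺⁺ give the crux (the
Alon–Boppana bookkeeping with wide gates inlined as constants-or-approximators). -/
def InlineOracleReduction (neg : ∀ m : ℕ, Finset ((⊤ : SimpleGraph (Fin m)).edgeSet → Bool)) : Prop :=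
  (∃ (δ : ℝ) (l M : ℕ → ℕ), 0 < δ ∧ δ < 1 / 2 ∧ SingleGateApproximable neg δ l M) → CliqueExtLowerBound

end Ledger

/-! ## §C  Card `constant-clique-transfer` (re-creation of the gen-0 sketch) -/

section ConstantK

/-- **C⁺ of the card**: for every budget exponent `c` some CONSTANT clique size `k = k(c)` already beats it
over the full basis (intended `k(c) ≈ 4(c+1)` by Rossman's `k/4`; note `k(c) ≥ c - 2` is forced by the
Disproof's §1/§7: brute force is one LP / one PERM gate of width `≤ w^{k+3}`). -/
def CPlus : Prop :=
  ∀ c : ℕ, ∃ k : ℕ, ∀ᶠ w : ℕ in atTop, ∀ C : Circuit ((⊤ : SimpleGraph (Fin w)).edgeSet),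
    C.IsOver (extGate (w ^ c)) → C.size ≤ w ^ c → ¬ C.Computes (cliqueFn w k)

/-- **Padding restriction** (support, provable now with `CircuitInputMap`/`CircuitPlug` and the constant gates
of `extGate s`): a circuit for `CLIQUE(m + j, k + j)` yields one for `CLIQUE(m, k)` over the same basis with
two more gates (fix a `j`-clique joined to everything). [folklore] -/
def CliqueRestriction : Prop :=
  ∀ (s m j k : ℕ) (C : Circuit ((⊤ : SimpleGraph (Fin (m + j))).edgeSet)),
    C.IsOver (extGate s) → C.Computes (cliqueFn (m + j) (k + j)) →
      ∃ C' : Circuit ((⊤ : SimpleGraph (Fin m)).edgeSet),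
        C'.IsOver (extGate s) ∧ C'.size ≤ C.size + 2 ∧ C'.Computes (cliqueFn m k)

/-- **ConstantCliqueTransfer** (support P1 of the card): `C⁺ → crux`. -/
def ConstantCliqueTransfer : Prop := CPlus → CliqueExtLowerBound

end ConstantK

end Summit.PneNP.PneNP.Cruxes.CliqueExtLowerBound.SketchIdeator3
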